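import Literature.NumberTheory.EllipticCurves.IwasawaAlgebraCharIdealProofs
import HarnessLib

/-!
# Route `ThetaPartnerAtTwo` (TP2), crux K3 `SignedKatoDivisibilityUpToAtTwo` (item stmt-BirchSwinnertonDyer-20308),
# line `colemanrat` v4 — SEMILINEAR TRANSPORT of the Iwasawa invariants (`Module.length`, `Module.lengthAt`,
# `Module.charIdeal`, torsion, cyclic quotients) along a RING ISOMORPHISM `σ : R ≃+* S`

Width seat `bsd-wall-tp2-p2x-w3` g3 (cell `bsd-wall`). HONEST FRAMING: THEOREMS ONLY — pure commutative algebra, no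
definition, no named fact, no instance, no `sorry`; route-independent (no `Theses` import); closes no item; BSD is NOT
proved by any of this.

## Why this file (the (R2′) repair of the K3 chain)

The lead's CONVENTION AUDIT of the registered stub (R2) `stub_localRobustPackageTwo`
(`Cruxes/SignedKatoDivisibilityUpToAtTwo/G4-CONVENTION-AUDIT.md`, confirmed by a second reader,
`W3G2-READER-G4-AUDIT.md`) found that in the TREE's conventions Kato's Iwasawa cohomology `I : Kato2004.IwasawaH1Data`
is `Λ`-COVARIANT (`T = conj_γ − 1`) while the pinned Pontryagin duals `SignedSelmerDualData W κ γ ε` /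
`FineSelmerDualData κ γ` carry `(T·x)(s) = x(conj_γ s) − x(s)` (PRE-composition) — the ι-TWIST of print's contragredient
module, `ι : T ↦ (1+T)⁻¹ − 1` the involution of `Λ = ℤ_p⟦T⟧`.  Every Poitou–Tate map `I.H → D.X` built from the
(Galois-invariant) local Tate pairing is therefore ι-SEMILINEAR, and (R2) as typed is stronger than print by an
ι-symmetry.  The print-exact repair (R2′) states the Coleman/Poitou–Tate package against the CONTRAGREDIENT data
(`γ⁻¹`-convention, print-linear) and bridges to K3's `γ`-convention datum `D` at the end by
«`charIdeal (M^ι) = ι (charIdeal M)`, `ℓ_𝔭(M^ι) = ℓ_{ι𝔭}(M)`» + the functional equation of `L♭` at `2` (in tree: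
`Literature.Barriers.BirchSwinnertonDyer.subst_invOnePlusSubOne_eq_rootNumber_of_isSprungPair_two`).  The audit names
this involution algebra as the ONE new item (R2′) costs.  This file is its RING-AGNOSTIC half: the transport of the
invariants of `IwasawaAlgebra.lean` along ANY ring isomorphism `σ : R ≃+* S` and ANY additive isomorphism `e : M ≃+ N`
that is `σ`-semilinear, `e (r • m) = σ r • e m` — stated WITHOUT `LinearEquiv`/`RingHomInvPair` instance binders and
without a twisted-module type synonym, so that it applies verbatim to `σ = ι`, `e = id : D.X → D′.X` (the same
character group with its two `Λ`-structures) and to `e = ` an ι-semilinear Poitou–Tate map.  The `Λ`-specific half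
(the involution `ι` itself, the prime bookkeeping `ι(𝔭) ∌ 2`, the twist `D ↦ D′` of the dual data, the FE bookkeeping)
is the companion file `…IwasawaInvolutionTwist`.

## What is proved (`σ : R ≃+* S` commutative rings, `e : M ≃+ N`, `he : ∀ r m, e (r • m) = σ r • e m`)

* §1 `length_eq` — `Module.length R M = Module.length S N` (Mathlib's `Submodule.orderIsoMapComapOfBijective`).
* §2 `isTorsion_of_semilinear`, `isTorsion_iff_of_semilinear` — `Module.IsTorsion R M ↔ Module.IsTorsion S N`
  (`map_mem_nonZeroDivisors`).
* §3 for primes `𝔭 = σ⁻¹(𝔓)` (`h𝔭 : 𝔭.asIdeal = 𝔓.asIdeal.comap σ`): `map_primeCompl` (`σ(R∖𝔭) = S∖𝔓`),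
  `exists_localizedModule_map` / `exists_localizedModule_equiv` (**the induced `M_𝔭 ≃+ N_𝔓`, `m/s ↦ e m/σ s`, is
  `σ_𝔭`-semilinear for `σ_𝔭 = IsLocalization.ringEquivOfRingEquiv … σ`**), hence
  **`lengthAt_eq : lengthAt R M 𝔭 = lengthAt S N 𝔓`** and `lengthAt_eq_of_map_eq` (`𝔓 = σ(𝔭)`).
* §4 `exists_mulEquiv_ideal_map` (`I ↦ σ(I)` is a `MulEquiv` of ideal monoids), `height_map_eq`, and
  **`charIdeal_eq_map : charIdeal S N = (charIdeal R M).map σ`** (`MulEquiv.map_finprod` + `finprod_mem_eq_of_bijOn`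
  over the bijection `𝔭 ↦ σ(𝔭)` of height-one primes, Mathlib's `RingEquiv.height_map/height_comap`).
* §5 `exists_quotient_equiv` (`R ⧸ I ≃+ S ⧸ σ(I)`, `σ`-semilinear: Mathlib's `Ideal.quotientEquiv`),
  `lengthAt_quotient_eq`, **`lengthAt_quotient_span_singleton_eq : ℓ_𝔭(R⧸(a)) = ℓ_𝔓(S⧸(σ a))`**.

References: [Bourbaki, Algèbre commutative VII §4.4–4.5] (characteristic ideal; transport of structure);
[Washington1997, §13.2]; [GreenbergLNM1716, §1 p. 60] (the involution `ι` and `X^ι`); [PerrinRiou1994, §1.3]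
(`M^ι`, `char(M^ι) = char(M)^ι`).
-/

set_option autoImplicit false
-- the Theorems namespace of this sub repeats the summit name by design (D-0017 nested layout)
set_option linter.dupNamespace false

noncomputable section

open scoped Classical

namespace Summit.BirchSwinnertonDyer.BirchSwinnertonDyer.Theorems

namespace SignedKatoOffTwo.SemilinearTransport

open Literature.NumberTheory.EllipticCurves Literature.NumberTheory.EllipticCurves.Module

universe u v w x

variable {R : Type u} {S : Type v} [CommRing R] [CommRing S] (σ : R ≃+* S)
  {M : Type w} {N : Type x} [AddCommGroup M] [Module R M] [AddCommGroup N] [Module S N]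
  (e : M ≃+ N)

/-! ## §1 Length -/

/-- **Length is invariant under semilinear isomorphism**: if `e : M ≃ N` is additive and `σ`-semilinear
for a ring isomorphism `σ : R ≃+* S`, then `length_R M = length_S N` (the submodule lattices are isomorphic).
[folklore] -/
theorem length_eq (he : ∀ (r : R) (m : M), e (r • m) = σ r • e m) :
    Module.length R M = Module.length S N := by
  haveI : RingHomSurjective (σ : R →+* S) := ⟨σ.surjective⟩
  let f : M →ₛₗ[(σ : R →+* S)] N :=
    { toFun := e, map_add' := fun a b ↦ e.map_add a b, map_smul' := he }
  apply WithBot.coe_injective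
  rw [Module.coe_length, Module.coe_length,
    Order.krullDim_eq_of_orderIso (Submodule.orderIsoMapComapOfBijective f e.bijective)]

/-! ## §2 Torsion -/

/-- `σ` maps non-zero-divisors to non-zero-divisors. [folklore] -/
theorem map_mem_nonZeroDivisors {a : R} (ha : a ∈ nonZeroDivisors R) : σ a ∈ nonZeroDivisors S := by
  rw [mem_nonZeroDivisors_iff_right] at ha ⊢
  intro t ht
  have h1 : σ.symm t * a = 0 := by
    apply σ.injective
    rw [map_mul, σ.apply_symm_apply, map_zero, ht]
  simpa using congrArg σ (ha _ h1)

/-- **Torsion is invariant under semilinear isomorphism.** [folklore] -/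
theorem isTorsion_of_semilinear (he : ∀ (r : R) (m : M), e (r • m) = σ r • e m)
    (hM : Module.IsTorsion R M) : Module.IsTorsion S N := by
  intro y
  obtain ⟨⟨a, ha⟩, hax⟩ := @hM (e.symm y)
  refine ⟨⟨σ a, map_mem_nonZeroDivisors σ ha⟩, ?_⟩
  have := congrArg e hax
  rw [Submonoid.mk_smul, he, e.apply_symm_apply, map_zero] at this
  simpa using this

/-- **Torsion is invariant under semilinear isomorphism** (iff form). [folklore] -/
theorem isTorsion_iff_of_semilinear (he : ∀ (r : R) (m : M), e (r • m) = σ r • e m) :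
    Module.IsTorsion R M ↔ Module.IsTorsion S N := by
  refine ⟨isTorsion_of_semilinear σ e he, fun hN ↦ ?_⟩
  refine isTorsion_of_semilinear σ.symm e.symm (fun s n ↦ ?_) hN
  apply e.injective
  rw [e.apply_symm_apply, he, σ.apply_symm_apply, e.apply_symm_apply]


/-! ## §3 Localisation at corresponding primes and the local lengths `lengthAt` -/

section Localization

variable {σ} {𝔭 : PrimeSpectrum R} {𝔓 : PrimeSpectrum S}

/-- If `𝔭 = σ⁻¹(𝔓)` then `σ` maps the complement of `𝔭` into the complement of `𝔓`. [folklore] -/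
theorem apply_mem_primeCompl (h𝔭 : 𝔭.asIdeal = 𝔓.asIdeal.comap σ) {s : R}
    (hs : s ∈ 𝔭.asIdeal.primeCompl) : σ s ∈ 𝔓.asIdeal.primeCompl := by
  rw [Ideal.mem_primeCompl_iff] at hs ⊢
  rwa [h𝔭, Ideal.mem_comap] at hs

/-- If `𝔭 = σ⁻¹(𝔓)` then `𝔓 = (σ⁻¹)⁻¹(𝔭)`. [folklore] -/
theorem symm_comap_eq (h𝔭 : 𝔭.asIdeal = 𝔓.asIdeal.comap σ) :
    𝔓.asIdeal = 𝔭.asIdeal.comap σ.symm := by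
  ext t
  rw [Ideal.mem_comap, h𝔭, Ideal.mem_comap, σ.apply_symm_apply]

/-- If `𝔭 = σ⁻¹(𝔓)` then `σ⁻¹` maps the complement of `𝔓` into the complement of `𝔭`. [folklore] -/
theorem symm_apply_mem_primeCompl (h𝔭 : 𝔭.asIdeal = 𝔓.asIdeal.comap σ) {t : S}
    (ht : t ∈ 𝔓.asIdeal.primeCompl) : σ.symm t ∈ 𝔭.asIdeal.primeCompl :=
  apply_mem_primeCompl (symm_comap_eq h𝔭) ht

/-- If `𝔭 = σ⁻¹(𝔓)` then `σ(R ∖ 𝔭) = S ∖ 𝔓` as submonoids. [folklore] -/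
theorem map_primeCompl (h𝔭 : 𝔭.asIdeal = 𝔓.asIdeal.comap σ) :
    𝔭.asIdeal.primeCompl.map σ.toMonoidHom = 𝔓.asIdeal.primeCompl := by
  ext t
  constructor
  · rintro ⟨s, hs, rfl⟩
    exact apply_mem_primeCompl h𝔭 hs
  · intro ht
    exact ⟨σ.symm t, symm_apply_mem_primeCompl h𝔭 ht, σ.apply_symm_apply t⟩

variable (σ)

/-- **The induced additive map on localised modules**: for `𝔭 = σ⁻¹(𝔓)` and a `σ`-semilinear additive
`e : M → N` there is an additive `φ : M_𝔭 → N_𝔓` with `φ (m / s) = e m / σ s`. [folklore] -/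
theorem exists_localizedModule_map (he : ∀ (r : R) (m : M), e (r • m) = σ r • e m)
    (h𝔭 : 𝔭.asIdeal = 𝔓.asIdeal.comap σ) :
    ∃ φ : LocalizedModule 𝔭.asIdeal.primeCompl M →+ LocalizedModule 𝔓.asIdeal.primeCompl N,
      ∀ (m : M) (s : 𝔭.asIdeal.primeCompl),
        φ (LocalizedModule.mk m s) = LocalizedModule.mk (e m) ⟨σ s, apply_mem_primeCompl h𝔭 s.2⟩ := by
  have wd : ∀ (p p' : M × 𝔭.asIdeal.primeCompl), p ≈ p' →
      (LocalizedModule.mk (e p.1) ⟨σ p.2, apply_mem_primeCompl h𝔭 p.2.2⟩ :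
          LocalizedModule 𝔓.asIdeal.primeCompl N) =
        LocalizedModule.mk (e p'.1) ⟨σ p'.2, apply_mem_primeCompl h𝔭 p'.2.2⟩ := by
    rintro ⟨m, s⟩ ⟨m', s'⟩ ⟨u, hu⟩
    refine LocalizedModule.mk_eq.mpr ⟨⟨σ u, apply_mem_primeCompl h𝔭 u.2⟩, ?_⟩
    have := congrArg e hu
    simp only [Submonoid.smul_def, he] at this ⊢
    exact this
  let φ : LocalizedModule 𝔭.asIdeal.primeCompl M → LocalizedModule 𝔓.asIdeal.primeCompl N :=
    fun z ↦ z.liftOn (fun p ↦ LocalizedModule.mk (e p.1) ⟨σ p.2, apply_mem_primeCompl h𝔭 p.2.2⟩) wd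
  have hφ : ∀ (m : M) (s : 𝔭.asIdeal.primeCompl),
      φ (LocalizedModule.mk m s) = LocalizedModule.mk (e m) ⟨σ s, apply_mem_primeCompl h𝔭 s.2⟩ :=
    fun m s ↦ LocalizedModule.liftOn_mk wd m s
  refine ⟨{ toFun := φ, map_zero' := ?_, map_add' := ?_ }, hφ⟩
  · rw [← LocalizedModule.zero_mk 1, hφ, map_zero, LocalizedModule.zero_mk]
  · intro z z'
    induction z with | h m s
    induction z' with | h m' s'
    rw [LocalizedModule.mk_add_mk, hφ, hφ, hφ, LocalizedModule.mk_add_mk]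
    congr 1
    · simp only [Submonoid.smul_def, map_add, he]
    · exact Subtype.ext (by simp)

/-- **The induced map on localised modules is a `σ_𝔭`-semilinear additive isomorphism**, where
`σ_𝔭 : R_𝔭 ≃+* S_𝔓` is the isomorphism of localisations induced by `σ`
(`IsLocalization.ringEquivOfRingEquiv`). [folklore] -/
theorem exists_localizedModule_equiv (he : ∀ (r : R) (m : M), e (r • m) = σ r • e m)
    (h𝔭 : 𝔭.asIdeal = 𝔓.asIdeal.comap σ) :
    ∃ Φ : LocalizedModule 𝔭.asIdeal.primeCompl M ≃+ LocalizedModule 𝔓.asIdeal.primeCompl N,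
      (∀ (m : M) (s : 𝔭.asIdeal.primeCompl),
        Φ (LocalizedModule.mk m s) = LocalizedModule.mk (e m) ⟨σ s, apply_mem_primeCompl h𝔭 s.2⟩) ∧
      ∀ (a : Localization.AtPrime 𝔭.asIdeal) (z : LocalizedModule 𝔭.asIdeal.primeCompl M),
        Φ (a • z) =
          IsLocalization.ringEquivOfRingEquiv (Localization.AtPrime 𝔭.asIdeal)
            (Localization.AtPrime 𝔓.asIdeal) σ (map_primeCompl h𝔭) a • Φ z := by
  obtain ⟨φ, hφ⟩ := exists_localizedModule_map σ e he h𝔭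
  have he' : ∀ (s : S) (n : N), e.symm (s • n) = σ.symm s • e.symm n := fun s n ↦ by
    apply e.injective
    rw [e.apply_symm_apply, he, σ.apply_symm_apply, e.apply_symm_apply]
  obtain ⟨ψ, hψ⟩ := exists_localizedModule_map σ.symm e.symm he' (symm_comap_eq h𝔭)
  have hψφ : ∀ z, ψ (φ z) = z := by
    intro z
    induction z with | h m s
    rw [hφ, hψ]
    congr 1
    · exact e.symm_apply_apply m
    · exact Subtype.ext (σ.symm_apply_apply _)
  have hφψ : ∀ y, φ (ψ y) = y := by
    intro y
    induction y with | h n t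
    rw [hψ, hφ]
    congr 1
    · exact e.apply_symm_apply n
    · exact Subtype.ext (σ.apply_symm_apply _)
  refine ⟨AddEquiv.mk ⟨φ, ψ, hψφ, hφψ⟩ φ.map_add, hφ, ?_⟩
  intro a z
  obtain ⟨r, s, rfl⟩ := IsLocalization.exists_mk'_eq 𝔭.asIdeal.primeCompl a
  induction z with | h m t
  change φ _ = _ • φ _
  rw [IsLocalization.ringEquivOfRingEquiv_mk', ← Localization.mk_eq_mk'_apply,
    ← Localization.mk_eq_mk'_apply, LocalizedModule.mk_smul_mk, hφ, hφ, LocalizedModule.mk_smul_mk]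
  congr 1
  · exact he r m
  · exact Subtype.ext (by simp)

/-- **Local lengths are invariant under semilinear isomorphism**: for `𝔭 = σ⁻¹(𝔓)`,
`ℓ_𝔭(M) = ℓ_𝔓(N)` (`Module.lengthAt`). [folklore] -/
theorem lengthAt_eq (he : ∀ (r : R) (m : M), e (r • m) = σ r • e m)
    (h𝔭 : 𝔭.asIdeal = 𝔓.asIdeal.comap σ) :
    lengthAt R M 𝔭 = lengthAt S N 𝔓 := by
  obtain ⟨Φ, -, hΦ⟩ := exists_localizedModule_equiv σ e he h𝔭
  exact length_eq _ Φ hΦ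

/-- The same with the prime of `S` written as `σ(𝔭)`: `ℓ_𝔭(M) = ℓ_{σ𝔭}(N)`. [folklore] -/
theorem lengthAt_eq_of_map_eq (he : ∀ (r : R) (m : M), e (r • m) = σ r • e m)
    (h𝔓 : 𝔓.asIdeal = 𝔭.asIdeal.map σ) :
    lengthAt R M 𝔭 = lengthAt S N 𝔓 := by
  refine lengthAt_eq σ e he ?_
  rw [h𝔓, Ideal.comap_map_of_bijective σ σ.bijective]

end Localization


/-! ## §4 The characteristic ideal -/

section CharIdeal

/-- `σ` induces a multiplicative equivalence `I ↦ σ(I)` of the monoids of ideals. [folklore] -/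
theorem exists_mulEquiv_ideal_map :
    ∃ Φ : Ideal R ≃* Ideal S, ∀ I, Φ I = I.map σ :=
  ⟨{ toFun := Ideal.map σ
     invFun := Ideal.map σ.symm
     left_inv := fun I ↦ by
       rw [Ideal.map_symm, Ideal.comap_map_of_bijective σ σ.bijective]
     right_inv := fun J ↦ by
       rw [Ideal.map_symm, Ideal.map_comap_of_surjective σ σ.surjective]
     map_mul' := Ideal.map_mul σ }, fun _ ↦ rfl⟩

/-- `σ` preserves the height of ideals (Mathlib's `RingEquiv.height_map`), in `PrimeSpectrum` form: the prime
`σ(𝔭)` has height one iff `𝔭` has. [folklore] -/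
theorem height_map_eq (𝔭 : PrimeSpectrum R) : (𝔭.asIdeal.map σ).height = 𝔭.asIdeal.height :=
  RingEquiv.height_map σ 𝔭.asIdeal

/-- **The characteristic ideal is transported by a semilinear isomorphism**:
`char_S(N) = σ(char_R(M))` (`Module.charIdeal = ∏_{ht 𝔭 = 1} 𝔭 ^ ℓ_𝔭`; the height-one primes of `S` are the
`σ(𝔭)`, and `ℓ_{σ𝔭}(N) = ℓ_𝔭(M)` by `lengthAt_eq_of_map_eq`). [folklore] -/
theorem charIdeal_eq_map (he : ∀ (r : R) (m : M), e (r • m) = σ r • e m) :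
    charIdeal S N = (charIdeal R M).map σ := by
  obtain ⟨Φ, hΦ⟩ := exists_mulEquiv_ideal_map σ
  rw [charIdeal, charIdeal, ← hΦ, MulEquiv.map_finprod]
  simp_rw [MulEquiv.map_finprod, map_pow, hΦ]
  symm
  refine finprod_mem_eq_of_bijOn
    (fun 𝔭 : PrimeSpectrum R ↦ (⟨𝔭.asIdeal.map σ, inferInstance⟩ : PrimeSpectrum S))
    ⟨fun 𝔭 h𝔭 ↦ ?_, fun 𝔭 _ 𝔮 _ h ↦ ?_, fun 𝔓 h𝔓 ↦ ?_⟩ fun 𝔭 _ ↦ ?_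
  · -- height-one primes go to height-one primes
    simp only [Set.mem_setOf_eq] at h𝔭 ⊢
    rw [height_map_eq, h𝔭]
  · -- injective
    have h' := congrArg (fun 𝔔 : PrimeSpectrum S ↦ 𝔔.asIdeal.comap σ) h
    simp only [Ideal.comap_map_of_bijective σ σ.bijective] at h'
    exact PrimeSpectrum.ext h'
  · -- onto the height-one primes of `S`
    simp only [Set.mem_setOf_eq] at h𝔓
    refine ⟨⟨𝔓.asIdeal.comap σ, inferInstance⟩, ?_, ?_⟩
    · simp only [Set.mem_setOf_eq]
      rw [RingEquiv.height_comap, h𝔓]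
    · exact PrimeSpectrum.ext (Ideal.map_comap_of_surjective σ σ.surjective _)
  · -- the exponents agree: `ℓ_𝔭(M) = ℓ_{σ𝔭}(N)`
    rw [lengthAt_eq_of_map_eq σ e he (𝔭 := 𝔭) (𝔓 := ⟨𝔭.asIdeal.map σ, inferInstance⟩) rfl]

end CharIdeal

/-! ## §5 Cyclic modules `R ⧸ I ↦ S ⧸ σ(I)` -/

section Quotient

/-- **`σ` induces a `σ`-semilinear additive isomorphism `R ⧸ I ≃ S ⧸ σ(I)`** (Mathlib's ring isomorphism
`Ideal.quotientEquiv`). [folklore] -/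
theorem exists_quotient_equiv (I : Ideal R) :
    ∃ Φ : (R ⧸ I) ≃+ (S ⧸ I.map σ),
      (∀ r : R, Φ (Ideal.Quotient.mk I r) = Ideal.Quotient.mk (I.map σ) (σ r)) ∧
      ∀ (r : R) (x : R ⧸ I), Φ (r • x) = σ r • Φ x := by
  have hIJ : I.map σ = I.map (σ : R →+* S) := (Ideal.map_coe σ I).symm
  refine ⟨(Ideal.quotientEquiv I (I.map σ) σ hIJ).toAddEquiv, fun r ↦ ?_, fun r x ↦ ?_⟩
  · exact Ideal.quotientEquiv_mk I (I.map σ) σ hIJ r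
  · obtain ⟨x, rfl⟩ := Ideal.Quotient.mk_surjective x
    rw [RingEquiv.toAddEquiv_eq_coe, RingEquiv.coe_toAddEquiv, Algebra.smul_def, Ideal.Quotient.algebraMap_eq,
      ← map_mul, Ideal.quotientEquiv_mk, Ideal.quotientEquiv_mk, map_mul, Algebra.smul_def,
      Ideal.Quotient.algebraMap_eq, map_mul]

variable {σ} {𝔭 : PrimeSpectrum R} {𝔓 : PrimeSpectrum S}

/-- **`ℓ_𝔭(R ⧸ I) = ℓ_{𝔓}(S ⧸ σ(I))`** for `𝔭 = σ⁻¹(𝔓)`. [folklore] -/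
theorem lengthAt_quotient_eq (I : Ideal R) (h𝔭 : 𝔭.asIdeal = 𝔓.asIdeal.comap σ) :
    lengthAt R (R ⧸ I) 𝔭 = lengthAt S (S ⧸ I.map σ) 𝔓 := by
  obtain ⟨Φ, -, hΦ⟩ := exists_quotient_equiv σ I
  exact lengthAt_eq σ Φ hΦ h𝔭

/-- **`ℓ_𝔭(R ⧸ (a)) = ℓ_{𝔓}(S ⧸ (σ a))`** for `𝔭 = σ⁻¹(𝔓)`. [folklore] -/
theorem lengthAt_quotient_span_singleton_eq (a : R) (h𝔭 : 𝔭.asIdeal = 𝔓.asIdeal.comap σ) :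
    lengthAt R (R ⧸ Ideal.span {a}) 𝔭 = lengthAt S (S ⧸ Ideal.span {σ a}) 𝔓 := by
  have h := lengthAt_quotient_eq (Ideal.span {a}) h𝔭
  rw [Ideal.map_span, Set.image_singleton] at h
  exact h

end Quotient

end SignedKatoOffTwo.SemilinearTransport

end Summit.BirchSwinnertonDyer.BirchSwinnertonDyer.Theorems

end
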